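import Literature.Analysis.SpecialFunctions.RiemannTheta
import Mathlib.MeasureTheory.Integral.Pi
import Mathlib.Analysis.SpecialFunctions.Integrals.Basic
import HarnessLib

/-!
# The Riemann theta function is not identically zero (its zeroth Fourier coefficient is `1`)

For a `g × g` complex matrix `Ω` with `Im Ω ≥ c > 0` (as a quadratic form; e.g. `Ω` in the Siegel
upper half space) the Riemann theta function `ϑ(z, Ω) = Σ_{m ∈ ℤ^g} exp(πi ᵗmΩm + 2πi ᵗm z)` of
`Literature/Analysis/SpecialFunctions/RiemannTheta.lean` is `ℤ^g`-periodic in `z`, and its Fourier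
coefficients are the `exp(πi ᵗmΩm)`; in particular the coefficient of `m = 0` is `1`, so `ϑ(·, Ω)`
does not vanish identically (Mumford, *Tata Lectures on Theta I*, Ch. II §1, where `ϑ` is introduced
as the Fourier series with these coefficients and shown to span the one-dimensional space of
holomorphic functions with its quasi-periodicity; Lange–Birkenhake, *Complex Abelian Varieties*,
§3.2 (Thm. 3.2.7: the classical theta functions form a basis of `H⁰(L)`, in particular are `≠ 0`)).

We prove this in the following elementary form, avoiding Fourier theory on the torus:

* `integral_riemannTheta_unitCube` — **`∫_{[0,1]^g} ϑ(x, Ω) dx = 1`** (the integral of the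
  absolutely convergent series is computed termwise, `MeasureTheory.integral_tsum_of_summable_integral_norm`;
  `∫_{[0,1]^g} exp(2πi ᵗm x) dx = ∏ᵢ ∫₀¹ exp(2πi mᵢ t) dt = [m = 0]` by Fubini,
  `MeasureTheory.integral_fin_nat_prod_eq_prod`, and `integral_exp_mul_complex`);
* `exists_riemannTheta_ofReal_ne_zero`, `exists_riemannTheta_ne_zero` — **`ϑ(·, Ω) ≢ 0`**, indeed
  `ϑ(x, Ω) ≠ 0` for some REAL `x ∈ ℝ^g`;
* the same under the hypothesis `Im Ω` positive definite (`…_of_posDef`).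

Everything is proved; no definitions, no named facts.

## References

* [MumfordTata1] D. Mumford, Tata Lectures on Theta I (1983), Ch. II §1.
* [LangeBirkenhake1992] H. Lange, Ch. Birkenhake, Complex Abelian Varieties (1992), §3.2 Thm. 3.2.7,
  §3.3.2 (3.10).
-/

noncomputable section

open Complex Real Finset Filter Topology MeasureTheory Set

namespace Literature.Analysis.SpecialFunctions

variable {g : ℕ}

/-! ### The general term at real points -/

/-- At a real point the general term factors as `exp(πi ᵗmΩm) · ∏ᵢ exp(2πi mᵢ xᵢ)`. [folklore] -/
theorem riemannThetaTerm_ofReal (Ω : Matrix (Fin g) (Fin g) ℂ) (x : Fin g → ℝ) (m : Fin g → ℤ) :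
    riemannThetaTerm Ω (fun i => (x i : ℂ)) m =
      cexp (π * I * ∑ i, ∑ j, (m i : ℂ) * Ω i j * (m j : ℂ)) *
        ∏ i, cexp (2 * π * I * (m i : ℂ) * (x i : ℂ)) := by
  unfold riemannThetaTerm
  rw [Complex.exp_add, ← Complex.exp_sum]
  congr 2
  rw [Finset.mul_sum]
  exact Finset.sum_congr rfl fun i _ => by ring

/-- At real points the size of the general term does not depend on the point:
`|exp(πi ᵗmΩm + 2πi ᵗm x)| = exp(-π ᵗm (Im Ω) m)`. [folklore] -/
theorem norm_riemannThetaTerm_ofReal (Ω : Matrix (Fin g) (Fin g) ℂ) (x : Fin g → ℝ)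
    (m : Fin g → ℤ) :
    ‖riemannThetaTerm Ω (fun i => (x i : ℂ)) m‖ = ‖riemannThetaTerm Ω 0 m‖ := by
  rw [norm_riemannThetaTerm, norm_riemannThetaTerm]
  simp

/-- The general term is continuous in the real point. [folklore] -/
theorem continuous_riemannThetaTerm_ofReal (Ω : Matrix (Fin g) (Fin g) ℂ) (m : Fin g → ℤ) :
    Continuous fun x : Fin g → ℝ => riemannThetaTerm Ω (fun i => (x i : ℂ)) m := by
  unfold riemannThetaTerm
  fun_prop

/-! ### The orthogonality relations `∫_{[0,1]^g} exp(2πi ᵗm x) dx = [m = 0]` -/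

/-- `∫₀¹ exp(2πi k t) dt = [k = 0]` for `k ∈ ℤ`. [folklore] -/
theorem integral_cexp_two_pi_mul_intCast (k : ℤ) :
    ∫ t in Set.Ioc (0 : ℝ) 1, cexp (2 * π * I * (k : ℂ) * (t : ℂ)) = if k = 0 then 1 else 0 := by
  rw [← intervalIntegral.integral_of_le zero_le_one]
  split_ifs with hk
  · subst hk
    simp
  · have hc : (2 * π * I * (k : ℂ)) ≠ 0 := by
      have hπ : (π : ℂ) ≠ 0 := Complex.ofReal_ne_zero.mpr Real.pi_ne_zero
      have hk' : (k : ℂ) ≠ 0 := Int.cast_ne_zero.mpr hk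
      exact mul_ne_zero (mul_ne_zero (mul_ne_zero two_ne_zero hπ) Complex.I_ne_zero) hk'
    rw [integral_exp_mul_complex hc]
    have h1 : cexp (2 * π * I * (k : ℂ) * ((1 : ℝ) : ℂ)) = 1 := by
      rw [Complex.ofReal_one, mul_one, show 2 * (π : ℂ) * I * (k : ℂ) = (k : ℂ) * (2 * π * I) by ring]
      exact Complex.exp_int_mul_two_pi_mul_I k
    rw [h1, Complex.ofReal_zero, mul_zero, Complex.exp_zero, sub_self, zero_div]

/-- **Orthogonality on the unit cube**: `∫_{[0,1]^g} ∏ᵢ exp(2πi mᵢ xᵢ) dx = [m = 0]` (Fubini).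
[folklore] -/
theorem integral_prod_cexp_two_pi_mul_intCast (m : Fin g → ℤ) :
    ∫ x : Fin g → ℝ, ∏ i, cexp (2 * π * I * (m i : ℂ) * (x i : ℂ))
        ∂(Measure.pi fun _ : Fin g => (volume : Measure ℝ).restrict (Set.Ioc 0 1)) =
      if m = 0 then 1 else 0 := by
  rw [integral_fin_nat_prod_eq_prod (𝕜 := ℂ)
    (μ := fun _ : Fin g => (volume : Measure ℝ).restrict (Set.Ioc 0 1))
    (fun i (t : ℝ) => cexp (2 * π * I * (m i : ℂ) * (t : ℂ)))]
  simp_rw [integral_cexp_two_pi_mul_intCast, Finset.prod_boole, Finset.mem_univ, true_imp_iff]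
  congr 1
  simp only [funext_iff, Pi.zero_apply]

/-! ### The integral of `ϑ` over the unit cube -/

/-- **The zeroth Fourier coefficient of `ϑ(·, Ω)` is `1`**: `∫_{[0,1]^g} ϑ(x, Ω) dx = 1`
(`Im Ω ≥ c > 0`). The absolutely convergent series is integrated termwise; only the term `m = 0`
survives. [cite: MumfordTata1, Ch. II §1] -/
theorem integral_riemannTheta_unitCube (Ω : Matrix (Fin g) (Fin g) ℂ) {c : ℝ} (hc : 0 < c)
    (hY : ∀ x : Fin g → ℝ, c * ∑ i, x i ^ 2 ≤ ∑ i, ∑ j, x i * (Ω i j).im * x j) :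
    ∫ x : Fin g → ℝ, riemannTheta Ω (fun i => (x i : ℂ))
        ∂(Measure.pi fun _ : Fin g => (volume : Measure ℝ).restrict (Set.Ioc 0 1)) = 1 := by
  set μ : Measure (Fin g → ℝ) :=
    Measure.pi fun _ : Fin g => (volume : Measure ℝ).restrict (Set.Ioc 0 1) with hμ
  haveI : ∀ i : Fin g, IsFiniteMeasure
      ((fun _ : Fin g => (volume : Measure ℝ).restrict (Set.Ioc 0 1)) i) := fun _ => by
    change IsFiniteMeasure ((volume : Measure ℝ).restrict (Set.Ioc 0 1))
    infer_instance
  haveI : IsFiniteMeasure μ := by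
    rw [hμ]
    infer_instance
  have hterm : ∀ m : Fin g → ℤ,
      ∫ x, riemannThetaTerm Ω (fun i => (x i : ℂ)) m ∂μ = if m = 0 then 1 else 0 := by
    intro m
    simp_rw [riemannThetaTerm_ofReal]
    rw [integral_const_mul, hμ, integral_prod_cexp_two_pi_mul_intCast]
    split_ifs with hm
    · subst hm
      simp
    · rw [mul_zero]
  have hint : ∀ m : Fin g → ℤ,
      Integrable (fun x : Fin g → ℝ => riemannThetaTerm Ω (fun i => (x i : ℂ)) m) μ := fun m =>
    (integrable_const ‖riemannThetaTerm Ω 0 m‖).mono'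
      (continuous_riemannThetaTerm_ofReal Ω m).aestronglyMeasurable
      (ae_of_all _ fun x => (norm_riemannThetaTerm_ofReal Ω x m).le)
  have hsum : Summable fun m : Fin g → ℤ =>
      ∫ x, ‖riemannThetaTerm Ω (fun i => (x i : ℂ)) m‖ ∂μ := by
    simp_rw [norm_riemannThetaTerm_ofReal, integral_const, smul_eq_mul]
    exact (summable_norm_riemannThetaTerm Ω hc hY 0).mul_left _
  calc ∫ x, riemannTheta Ω (fun i => (x i : ℂ)) ∂μ
      = ∫ x, ∑' m : Fin g → ℤ, riemannThetaTerm Ω (fun i => (x i : ℂ)) m ∂μ := rfl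
    _ = ∑' m : Fin g → ℤ, ∫ x, riemannThetaTerm Ω (fun i => (x i : ℂ)) m ∂μ :=
        (integral_tsum_of_summable_integral_norm hint hsum).symm
    _ = ∑' m : Fin g → ℤ, if m = 0 then (1 : ℂ) else 0 := tsum_congr hterm
    _ = 1 := tsum_ite_eq 0 1

/-! ### `ϑ ≢ 0` -/

/-- **The Riemann theta function is not identically zero: `ϑ(x, Ω) ≠ 0` for some real `x`**
(`Im Ω ≥ c > 0`). [cite: MumfordTata1, Ch. II §1] [cite: LangeBirkenhake1992, §3.2 Thm. 3.2.7] -/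
theorem exists_riemannTheta_ofReal_ne_zero (Ω : Matrix (Fin g) (Fin g) ℂ) {c : ℝ} (hc : 0 < c)
    (hY : ∀ x : Fin g → ℝ, c * ∑ i, x i ^ 2 ≤ ∑ i, ∑ j, x i * (Ω i j).im * x j) :
    ∃ x : Fin g → ℝ, riemannTheta Ω (fun i => (x i : ℂ)) ≠ 0 := by
  by_contra! h
  have h1 := integral_riemannTheta_unitCube Ω hc hY
  simp_rw [h, integral_zero] at h1
  exact zero_ne_one h1

/-- **The Riemann theta function is not identically zero** (`Im Ω ≥ c > 0`).
[cite: MumfordTata1, Ch. II §1] [cite: LangeBirkenhake1992, §3.2 Thm. 3.2.7] -/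
theorem exists_riemannTheta_ne_zero (Ω : Matrix (Fin g) (Fin g) ℂ) {c : ℝ} (hc : 0 < c)
    (hY : ∀ x : Fin g → ℝ, c * ∑ i, x i ^ 2 ≤ ∑ i, ∑ j, x i * (Ω i j).im * x j) :
    ∃ z : Fin g → ℂ, riemannTheta Ω z ≠ 0 := by
  obtain ⟨x, hx⟩ := exists_riemannTheta_ofReal_ne_zero Ω hc hY
  exact ⟨_, hx⟩

/-- `ϑ(·, Ω)` is not the zero function (`Im Ω ≥ c > 0`). [cite: MumfordTata1, Ch. II §1] -/
theorem riemannTheta_ne_zero (Ω : Matrix (Fin g) (Fin g) ℂ) {c : ℝ} (hc : 0 < c)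
    (hY : ∀ x : Fin g → ℝ, c * ∑ i, x i ^ 2 ≤ ∑ i, ∑ j, x i * (Ω i j).im * x j) :
    riemannTheta Ω ≠ 0 := by
  obtain ⟨z, hz⟩ := exists_riemannTheta_ne_zero Ω hc hY
  exact fun h => hz (by rw [h, Pi.zero_apply])

/-- **`ϑ(·, Ω) ≢ 0` for `Ω` with positive definite imaginary part** (e.g. `Ω` in the Siegel upper
half space). [cite: MumfordTata1, Ch. II §1] [cite: LangeBirkenhake1992, §3.2 Thm. 3.2.7] -/
theorem exists_riemannTheta_ne_zero_of_posDef (Ω : Matrix (Fin g) (Fin g) ℂ)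
    (hΩ : (Matrix.of fun i j => (Ω i j).im).PosDef) :
    ∃ z : Fin g → ℂ, riemannTheta Ω z ≠ 0 := by
  obtain ⟨c, hc, hY⟩ := exists_pos_mul_sum_sq_le_of_posDef_im Ω hΩ
  exact exists_riemannTheta_ne_zero Ω hc hY

/-- `ϑ(·, Ω) ≠ 0` for `Ω` with positive definite imaginary part. [cite: MumfordTata1, Ch. II §1] -/
theorem riemannTheta_ne_zero_of_posDef (Ω : Matrix (Fin g) (Fin g) ℂ)
    (hΩ : (Matrix.of fun i j => (Ω i j).im).PosDef) : riemannTheta Ω ≠ 0 := by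
  obtain ⟨c, hc, hY⟩ := exists_pos_mul_sum_sq_le_of_posDef_im Ω hΩ
  exact riemannTheta_ne_zero Ω hc hY

end Literature.Analysis.SpecialFunctions

end
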